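import Literature.MathematicalPhysics.QuantumLattice.HubbardFerrimagneticOrder
import HarnessLib

/-!
# Shen–Qiu–Tian: explicit signs of the spin correlations in the ground state of the half-filled
# Hubbard model (Tasaki 1998, Theorem 5.3), for every member and for the multiplet average

Topic `MathematicalPhysics/QuantumLattice` (family `hubbard`). Cell `pub/hubbard-cq`, seat
`hubbard-pc-lit-1`. HONEST FRAMING: a finite-volume KERNEL at half filling, bipartite hopping
(`t' = 0`), any `U > 0`; the printed strict inequalities are proved in their NON-STRICT form.

Setting (as in `HubbardFerrimagneticOrder`): `H = hamiltonian G t U` on a finite connected graph `G`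
on an ordered site set `Λ`, bipartite with colour class `A` (`x ∼ y → (x ∈ A ↔ y ∉ A)`), `t ≠ 0`,
`U > 0`, half filling `N = |Λ|`, NO balance hypothesis `|A| = |Aᶜ|`; `ε_x = stagSign A x = ±1`;
`S₀ = liebSpin A = ||A| - |Aᶜ||/2`. When `|A| ≠ |Aᶜ|` the half-filled ground state is a
`(2S₀+1)`-fold degenerate spin multiplet (Lieb), and "the ground-state expectation" of Tasaki's
Theorem 5.3 is the expectation in THE ground state — here, for statements that are not `SU(2)`
scalars member by member, and for all statements in the **tracial half-filled ground state**
`ω(O) = tr (P O) / tr P`, `P = sectorGroundProj H (nParticleSubmodule |Λ|)` the orthogonal projection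
onto the half-filled ground multiplet (`Matrix.projState`, Tasaki (2020) §2.1: the uniform average
over the ground states; the zero-temperature limit of the canonical Gibbs state).

* `hamiltonian_mulVec_sectorProj_eq_sectorEnergy` — every `(N↑, N↓) = (a, b)` component of an
  `N`-particle ground-energy eigenvector is a lowest vector of its sector (any graph, `t`, `U`).
* `groundState_sign_rule` — **the transverse sign rule for EVERY half-filled ground state** `ψ`
  (no `S^z` hypothesis, `|Λ|` of either parity): `ε_x ε_y ⟨ψ, S⁺_x S⁻_y ψ⟩ ≥ 0`
  (sector decomposition + the per-sector Gram block `LiebTwo.sector_sign_rule`).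
* `projState_spinPlus_mul_spinMinus_of_commute`, `projState_spinMinus_mul_spinPlus_of_commute`,
  `projState_fermionSpinDot_of_commute` — **isotropy of an `SU(2)`-invariant tracial state**: if
  `P` commutes with `S⁻` (resp. `S⁺`) then `ω(S⁺_x S⁻_y) = 2 ω(S^z_x S^z_y)`
  (resp. `ω(S⁻_x S⁺_y) = 2 ω(S^z_x S^z_y)`), hence `ω(𝐒_x·𝐒_y) = 3 ω(S^z_x S^z_y) = (3/2) ω(S⁺_x S⁻_y)`
  (trace cyclicity and `[S⁺_x, S⁻] = 2S^z_x`, `[S^z_y, S⁻] = -S⁻_y`).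
* `HalfFilledGroundState.sign_rule_transverse/longitudinal`, `HalfFilledGroundState.sign_rule` —
  **Shen–Qiu–Tian's theorem (Tasaki 1998, Theorem 5.3), non-strict form, in the tracial half-filled
  ground state**: `ε_x ε_y ω(S⁺_x S⁻_y) ≥ 0`, `ε_x ε_y ω(S^z_x S^z_y) ≥ 0`, `ε_x ε_y ω(𝐒_x·𝐒_y) ≥ 0`, i.e.
  `ω(𝐒_x·𝐒_y) ≥ 0` on equal and `≤ 0` on opposite sublattices
  (`fermionSpinDot_nonneg_of_same`, `fermionSpinDot_nonpos_of_opposite`).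
* `HalfFilledGroundState.projState_spinSq`, `liebSpin_le_projState_stagSpinStructure`,
  `ferrimagnetic_order` (`|Λ|` even) — **ferrimagnetic order of the tracial ground state**:
  `ω(Σ_{x,y} 𝐒_x·𝐒_y) = S₀(S₀+1)` (Lieb) and `ω(𝓢_A) ≥ S₀(S₀+1) ≥ ¼(|A| - |Aᶜ|)²`
  (`𝓢_A = S² - 4Σ_{x∈A,y∈Aᶜ} 𝐒_x·𝐒_y` and the sign rule): the `TODO(general member)` of
  `HubbardFerrimagneticOrder` (there only the `S^z = 0` member) in its multiplet-average form.

## References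
* S.-Q. Shen, Z.-M. Qiu, G.-S. Tian, *Ferrimagnetic long-range order of the Hubbard model*,
  Phys. Rev. Lett. 72 (1994) 1280–1282 — Theorem and eqs. (7)–(9). [ShenQiuTian1994]
  (paywalled, acquisition `acq-07059` open; statement taken from Tasaki 1998, Theorem 5.3.)
* H. Tasaki, *The Hubbard model — an introduction and selected rigorous results*, J. Phys.:
  Condens. Matter 10 (1998) 4353, Theorem 5.3 ("explicit signs of correlations", proved by Shen, Qiu
  and Tian by extending Lieb's method) and §5.3 (Lieb's ferrimagnetism). [Tasaki1998]
* E. H. Lieb, *Two theorems on the Hubbard model*, Phys. Rev. Lett. 62 (1989) 1201, Theorem 2.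
  [LiebPRL1989]
* H. Tasaki, *Physics and Mathematics of Quantum Many-Body Systems* (2020), §2.1 (ground states and
  their expectations, symmetry). [Tasaki2020]
* F. H. L. Essler et al., *The One-Dimensional Hubbard Model* (2005), §2.2.5 (local spin algebra).
  [EsslerEtAl2005]
-/

noncomputable section

namespace Literature.MathematicalPhysics.QuantumLattice

open Matrix Finset LiebThm1 LiebTwo FermionSpinMoment
open scoped ComplexOrder

/-! ### Sector components of a ground state and the sign rule for every ground state -/

section SectorComponents

variable {Λ : Type*} [LinearOrder Λ] [Fintype Λ]

/-- The sector restriction is an orthogonal projection: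
`⟨ψ, Π_{ab} φ⟩ = ⟨Π_{ab} ψ, Π_{ab} φ⟩`. [folklore] -/
private theorem star_dotProduct_sectorProj (a b : ℕ) (ψ φ : Fock (Orb Λ)) :
    star ψ ⬝ᵥ sectorProj a b φ = star (sectorProj a b ψ) ⬝ᵥ sectorProj a b φ := by
  rw [dotProduct, dotProduct]
  refine Finset.sum_congr rfl fun s _ => ?_
  simp only [Pi.star_apply, sectorProj_apply]
  split_ifs <;> simp

/-- A product (spin-raising matrix) · (spin-lowering matrix) conserves `(N↑, N↓)`. [folklore] -/
private theorem preservesSectors_mul_of_raises_lowers'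
    {P M : Matrix (Finset (Orb Λ)) (Finset (Orb Λ)) ℂ}
    (hP : RaisesSpin P) (hM : LowersSpin M) : PreservesSectors (P * M) := by
  intro s s' h
  rw [Matrix.mul_apply] at h
  obtain ⟨u, -, hu⟩ := Finset.exists_ne_zero_of_sum_ne_zero h
  have h1 := hP s u (left_ne_zero_of_mul hu)
  have h2 := hM u s' (right_ne_zero_of_mul hu)
  omega

/-- `S⁺_x S⁻_y` conserves `(N↑, N↓)`. Lieb, PRL 62 (1989) 1201, eq. (2). [cite: LiebPRL1989, eq. (2)] -/
theorem preservesSectors_fermionSpinPlus_mul_fermionSpinMinus (x y : Λ) :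
    PreservesSectors (fermionSpinPlus x * fermionSpinMinus y) := by
  have hy : LowersSpin (fermionSpinMinus y) := by
    rw [← conjTranspose_fermionSpinPlus]
    exact (raisesSpin_flip y).conjTranspose
  exact preservesSectors_mul_of_raises_lowers' (raisesSpin_flip x) hy

/-- **Sector decomposition of an expectation**: for a `(N↑, N↓)`-conserving `O` and an `N`-particle
`ψ = Σ_a Π_{a,N-a} ψ`, `⟨ψ, O ψ⟩ = Σ_a ⟨Π_{a,N-a} ψ, O Π_{a,N-a} ψ⟩` (the sectors are orthogonal and
`O`-invariant). Lieb, PRL 62 (1989) 1201, proof of Theorem 1 (`S^z` is conserved).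
[cite: LiebPRL1989, proof of Theorem 1] -/
theorem expect_eq_sum_expect_sectorProj {O : Matrix (Finset (Orb Λ)) (Finset (Orb Λ)) ℂ}
    (hO : PreservesSectors O) {N : ℕ} {ψ : Fock (Orb Λ)} (hN : IsNParticle N ψ) :
    star ψ ⬝ᵥ (O *ᵥ ψ) =
      ∑ a ∈ range (N + 1), star (sectorProj a (N - a) ψ) ⬝ᵥ (O *ᵥ sectorProj a (N - a) ψ) := by
  have h : O *ᵥ ψ = ∑ a ∈ range (N + 1), O *ᵥ sectorProj a (N - a) ψ := by
    rw [← Matrix.mulVec_sum, sum_sectorProj_eq hN]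
  rw [h, dotProduct_sum]
  refine Finset.sum_congr rfl fun a _ => ?_
  rw [hO.mulVec_sectorProj, star_dotProduct_sectorProj, ← hO.mulVec_sectorProj]

variable (G : SimpleGraph Λ) [DecidableRel G.Adj]

/-- **Every sector component of a ground-energy eigenvector is a lowest vector of its sector.**
If `H ψ = E₀(N) ψ` (`E₀(N) = groundEnergyAt`, the `N`-particle ground energy) then the component
`Π_{ab} ψ`, `a + b = N`, satisfies `H Π_{ab} ψ = E(a,b) Π_{ab} ψ` with
`E(a, b) = H.minEnergyOn (szSector (a+b) ((a-b)/2))` the sector energy: `H` commutes with `Π_{ab}`,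
`E₀(N) ≤ E(a, b)` (`hubbard_groundEnergyAt_le_minEnergyOn_szSector`) and, if `Π_{ab} ψ ≠ 0`, the
variational principle gives `E(a, b) ≤ E₀(N)`. Any graph, `t`, `U`. Lieb, PRL 62 (1989) 1201, proof
of Theorem 1. [cite: LiebPRL1989, proof of Theorem 1] -/
theorem hamiltonian_mulVec_sectorProj_eq_sectorEnergy {t U : ℝ} {N : ℕ} {ψ : Fock (Orb Λ)}
    (hHψ : hamiltonian G t U *ᵥ ψ = ((groundEnergyAt G t U N : ℝ) : ℂ) • ψ) {a b : ℕ}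
    (hab : a + b = N) :
    hamiltonian G t U *ᵥ sectorProj a b ψ =
      (((hamiltonian G t U).minEnergyOn (szSector (a + b) (((a : ℝ) - b) / 2)) : ℝ) : ℂ) •
        sectorProj a b ψ := by
  subst hab
  set φ := sectorProj a b ψ with hφ
  have hHφ : hamiltonian G t U *ᵥ φ = ((groundEnergyAt G t U (a + b) : ℝ) : ℂ) • φ := by
    rw [hφ, (preservesSectors_hamiltonian G t U).mulVec_sectorProj, hHψ, sectorProj_smul]
  by_cases h0 : φ = 0
  · rw [h0, mulVec_zero, smul_zero]
  have hsec : IsInSector a b φ := isInSector_sectorProj a b ψ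
  obtain ⟨ha, hb⟩ := le_card_of_isInSector hsec h0
  have hle : groundEnergyAt G t U (a + b) ≤
      (hamiltonian G t U).minEnergyOn (szSector (a + b) (((a : ℝ) - b) / 2)) :=
    hubbard_groundEnergyAt_le_minEnergyOn_szSector G t U a b rfl rfl ha hb
  have hge : (hamiltonian G t U).minEnergyOn (szSector (a + b) (((a : ℝ) - b) / 2)) ≤
      groundEnergyAt G t U (a + b) := by
    obtain ⟨c, -, hc1⟩ := exists_smul_unit h0
    have hmem : c • φ ∈ szSector (a + b) (((a : ℝ) - b) / 2) :=
      (mem_szSector_iff_isInSector a b _).2 (hsec.smul c)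
    have h := minEnergyOn_mul_le_re_rayleigh (hamiltonian_isHermitian G t U) _ hmem
    rwa [hc1, Complex.one_re, mul_one, mulVec_smul, hHφ, smul_comm, dotProduct_smul, hc1,
      smul_eq_mul, mul_one, Complex.ofReal_re] at h
  rw [hHφ, le_antisymm hle hge]

variable {G}

/-- **The transverse sign rule for EVERY half-filled ground state** (any `|A|, |Aᶜ|`, no `S^z`
hypothesis, `|Λ|` of either parity): on a connected bipartite graph with colour class `A`, `t ≠ 0`,
`U > 0`, every ground state `ψ` of the `N = |Λ|`-particle Hubbard Hamiltonian satisfies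
`ε_x ε_y ⟨ψ, S⁺_x S⁻_y ψ⟩ ≥ 0` for all sites `x, y` (decompose `ψ` into its `(N↑, N↓)` components,
each a lowest vector of its sector, and apply the per-sector rule `LiebTwo.sector_sign_rule`; the
cross terms vanish since `S⁺_x S⁻_y` conserves `(N↑, N↓)`).
[cite: ShenQiuTian1994, Theorem and eqs. (7)–(9)] [cite: Tasaki1998, Theorem 5.3] -/
theorem groundState_sign_rule (hG : G.Connected) (A : Finset Λ)
    (hA : ∀ x y : Λ, G.Adj x y → (x ∈ A ↔ y ∉ A)) {t U : ℝ} (ht : t ≠ 0) (hU : 0 < U)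
    {ψ : Fock (Orb Λ)} (hψ : IsGroundState (hamiltonian G t U) (Fintype.card Λ) ψ) (x y : Λ) :
    0 ≤ stagSign A x * stagSign A y *
      (star ψ ⬝ᵥ ((fermionSpinPlus x * fermionSpinMinus y) *ᵥ ψ)) := by
  rw [expect_eq_sum_expect_sectorProj (preservesSectors_fermionSpinPlus_mul_fermionSpinMinus x y)
    hψ.1, Finset.mul_sum]
  refine Finset.sum_nonneg fun a ha => ?_
  have haN : a + (Fintype.card Λ - a) = Fintype.card Λ :=
    Nat.add_sub_cancel' (Nat.lt_succ_iff.mp (Finset.mem_range.mp ha))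
  exact sector_sign_rule hG A hA ht hU haN (isInSector_sectorProj _ _ _)
    (hamiltonian_mulVec_sectorProj_eq_sectorEnergy G hψ.2.2 haN) x y

/-- Real-part form: `0 ≤ ε_x ε_y Re ⟨ψ, S⁺_x S⁻_y ψ⟩` for every half-filled ground state `ψ`.
[cite: ShenQiuTian1994, Theorem and eqs. (7)–(9)] -/
theorem groundState_sign_rule_re (hG : G.Connected) (A : Finset Λ)
    (hA : ∀ x y : Λ, G.Adj x y → (x ∈ A ↔ y ∉ A)) {t U : ℝ} (ht : t ≠ 0) (hU : 0 < U)
    {ψ : Fock (Orb Λ)} (hψ : IsGroundState (hamiltonian G t U) (Fintype.card Λ) ψ) (x y : Λ) :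
    0 ≤ ((stagSign A x * stagSign A y) *
      (star ψ ⬝ᵥ ((fermionSpinPlus x * fermionSpinMinus y) *ᵥ ψ))).re :=
  (Complex.nonneg_iff.mp (groundState_sign_rule hG A hA ht hU hψ x y)).1

end SectorComponents

/-! ### Isotropy of an `SU(2)`-invariant tracial state -/

section Isotropy

variable {Λ : Type*} [LinearOrder Λ] [Fintype Λ]

/-- Trace cyclicity: if `P U = U P` then `ω_P(X U) = ω_P(U X)`. [folklore] -/
private theorem projState_mul_comm_of_commute {P U : Matrix (Finset (Orb Λ)) (Finset (Orb Λ)) ℂ}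
    (hPU : P * U = U * P) (X : Matrix (Finset (Orb Λ)) (Finset (Orb Λ)) ℂ) :
    P.projState (X * U) = P.projState (U * X) := by
  rw [Matrix.projState_apply, Matrix.projState_apply, ← Matrix.mul_assoc, Matrix.trace_mul_comm,
    ← Matrix.mul_assoc, ← hPU, Matrix.mul_assoc]

/-- **Isotropy, `+-` component, of a tracial state commuting with `S⁻`**:
`ω_P(S⁺_x S⁻_y) = 2 ω_P(S^z_x S^z_y)` whenever `P S⁻ = S⁻ P`
(`S⁺_x S⁻_y = S⁻ (S⁺_x S^z_y) + 2 S^z_x S^z_y - (S⁺_x S^z_y) S⁻` and trace cyclicity).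
[cite: EsslerEtAl2005, §2.2.5 eqs. (2.71)–(2.73)] [cite: Tasaki2020, §2.1] -/
theorem projState_spinPlus_mul_spinMinus_of_commute
    {P : Matrix (Finset (Orb Λ)) (Finset (Orb Λ)) ℂ} (hP : P * spinMinus = spinMinus * P)
    (x y : Λ) :
    P.projState (fermionSpinPlus x * fermionSpinMinus y) =
      2 * P.projState (fermionSpinZ x * fermionSpinZ y) := by
  have hB : fermionSpinMinus y = spinMinus * fermionSpinZ y - fermionSpinZ y * spinMinus := by
    rw [← neg_sub, fermionSpinZ_mul_spinMinus_sub, neg_neg]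
  have hA : fermionSpinPlus x * spinMinus =
      spinMinus * fermionSpinPlus x + (2 : ℂ) • fermionSpinZ x := by
    rw [← fermionSpinPlus_mul_spinMinus_sub]; abel
  have hO : fermionSpinPlus x * fermionSpinMinus y =
      spinMinus * (fermionSpinPlus x * fermionSpinZ y) + (2 : ℂ) • (fermionSpinZ x * fermionSpinZ y) -
        fermionSpinPlus x * fermionSpinZ y * spinMinus := by
    rw [hB, mul_sub, ← Matrix.mul_assoc, ← Matrix.mul_assoc, hA, add_mul, smul_mul_assoc,
      Matrix.mul_assoc spinMinus]
  rw [hO, map_sub, map_add, map_smul, projState_mul_comm_of_commute hP, smul_eq_mul]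
  ring

/-- **Isotropy, `-+` component, of a tracial state commuting with `S⁺`**:
`ω_P(S⁻_x S⁺_y) = 2 ω_P(S^z_x S^z_y)` whenever `P S⁺ = S⁺ P`.
[cite: EsslerEtAl2005, §2.2.5 eqs. (2.71)–(2.73)] [cite: Tasaki2020, §2.1] -/
theorem projState_spinMinus_mul_spinPlus_of_commute
    {P : Matrix (Finset (Orb Λ)) (Finset (Orb Λ)) ℂ} (hP : P * spinPlus = spinPlus * P)
    (x y : Λ) :
    P.projState (fermionSpinMinus x * fermionSpinPlus y) =
      2 * P.projState (fermionSpinZ x * fermionSpinZ y) := by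
  have hB : fermionSpinPlus y = fermionSpinZ y * spinPlus - spinPlus * fermionSpinZ y :=
    (fermionSpinZ_mul_spinPlus_sub y).symm
  have hA : fermionSpinMinus x * spinPlus =
      spinPlus * fermionSpinMinus x - (2 : ℂ) • fermionSpinZ x := by
    rw [sub_eq_add_neg, ← fermionSpinMinus_mul_spinPlus_sub]; abel
  have hO : fermionSpinMinus x * fermionSpinPlus y =
      fermionSpinMinus x * fermionSpinZ y * spinPlus - spinPlus * (fermionSpinMinus x * fermionSpinZ y) +
        (2 : ℂ) • (fermionSpinZ x * fermionSpinZ y) := by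
    rw [hB, mul_sub, ← Matrix.mul_assoc, ← Matrix.mul_assoc, hA, sub_mul, smul_mul_assoc,
      Matrix.mul_assoc spinPlus]
    abel
  rw [hO, map_add, map_sub, map_smul, projState_mul_comm_of_commute hP, smul_eq_mul]
  ring

/-- **`SU(2)` isotropy of the spin correlation in a tracial state commuting with `S^±`**:
`ω_P(𝐒_x·𝐒_y) = 3 ω_P(S^z_x S^z_y)`. [cite: EsslerEtAl2005, §2.2.5 eqs. (2.71)–(2.73)]
[cite: Tasaki2020, §2.1] -/
theorem projState_fermionSpinDot_of_commute
    {P : Matrix (Finset (Orb Λ)) (Finset (Orb Λ)) ℂ} (hPm : P * spinMinus = spinMinus * P)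
    (hPp : P * spinPlus = spinPlus * P) (x y : Λ) :
    P.projState (fermionSpinDot x y) = 3 * P.projState (fermionSpinZ x * fermionSpinZ y) := by
  rw [fermionSpinDot_def, map_add, map_smul, map_add, projState_spinPlus_mul_spinMinus_of_commute hPm,
    projState_spinMinus_mul_spinPlus_of_commute hPp, smul_eq_mul]
  ring

/-- `ω_P(𝐒_x·𝐒_y) = (3/2) ω_P(S⁺_x S⁻_y)` in a tracial state commuting with `S^±`.
[cite: EsslerEtAl2005, §2.2.5 eqs. (2.71)–(2.73)] [cite: Tasaki2020, §2.1] -/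
theorem projState_fermionSpinDot_of_commute' {P : Matrix (Finset (Orb Λ)) (Finset (Orb Λ)) ℂ}
    (hPm : P * spinMinus = spinMinus * P) (hPp : P * spinPlus = spinPlus * P) (x y : Λ) :
    P.projState (fermionSpinDot x y) =
      ((3 / 2 : ℝ) : ℂ) * P.projState (fermionSpinPlus x * fermionSpinMinus y) := by
  rw [projState_fermionSpinDot_of_commute hPm hPp, projState_spinPlus_mul_spinMinus_of_commute hPm]
  push_cast
  ring

end Isotropy

/-! ### The tracial half-filled ground state: Shen–Qiu–Tian's theorem and ferrimagnetic order -/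

namespace HalfFilledGroundState

variable {Λ : Type*} [LinearOrder Λ] [Fintype Λ] (G : SimpleGraph Λ) [DecidableRel G.Adj]

/-- The ground projection of the `N`-particle sector commutes with `S⁻` (`[H, S⁻] = 0`,
`[N, S^±] = 0`). Tasaki (2020) §2.1 (symmetry of ground-state expectations). [cite: Tasaki2020, §2.1] -/
theorem sectorGroundProj_mul_spinMinus (t U : ℝ) (N : ℕ) :
    (hamiltonian G t U).sectorGroundProj (nParticleSubmodule (ι := Orb Λ) N) * spinMinus =
      spinMinus * (hamiltonian G t U).sectorGroundProj (nParticleSubmodule (ι := Orb Λ) N) := by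
  refine Matrix.sectorGroundProj_commute (hamiltonian_isHermitian G t U) _
    (hamiltonian_commute_spinMinus G t U).eq.symm (fun v hv => ?_) (fun v hv => ?_)
  · rw [mem_nParticleSubmodule_iff] at hv ⊢
    exact LiebTwo.isNParticle_mulVec_of_commute hv LiebTwo.totalNumber_mul_spinMinus
  · rw [mem_nParticleSubmodule_iff] at hv ⊢
    rw [spinMinus, conjTranspose_conjTranspose]
    exact LiebTwo.isNParticle_mulVec_of_commute hv LiebTwo.totalNumber_mul_spinPlus

/-- The ground projection of the `N`-particle sector commutes with `S⁺`. [cite: Tasaki2020, §2.1] -/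
theorem sectorGroundProj_mul_spinPlus (t U : ℝ) (N : ℕ) :
    (hamiltonian G t U).sectorGroundProj (nParticleSubmodule (ι := Orb Λ) N) * spinPlus =
      spinPlus * (hamiltonian G t U).sectorGroundProj (nParticleSubmodule (ι := Orb Λ) N) := by
  refine Matrix.sectorGroundProj_commute (hamiltonian_isHermitian G t U) _
    (hamiltonian_commute_spinPlus G t U).eq.symm (fun v hv => ?_) (fun v hv => ?_)
  · rw [mem_nParticleSubmodule_iff] at hv ⊢
    exact LiebTwo.isNParticle_mulVec_of_commute hv LiebTwo.totalNumber_mul_spinPlus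
  · rw [mem_nParticleSubmodule_iff] at hv ⊢
    have h : (spinPlus : Matrix (Finset (Orb Λ)) (Finset (Orb Λ)) ℂ)ᴴ = spinMinus := rfl
    rw [h]
    exact LiebTwo.isNParticle_mulVec_of_commute hv LiebTwo.totalNumber_mul_spinMinus

/-- **Isotropy of the tracial ground state**: `ω(𝐒_x·𝐒_y) = 3 ω(S^z_x S^z_y)` and
`ω(S⁺_x S⁻_y) = ω(S⁻_x S⁺_y) = 2 ω(S^z_x S^z_y)` for the tracial ground state of any `N`-particle
sector, any graph, `t`, `U`. Tasaki (2020) §2.1. [cite: Tasaki2020, §2.1] -/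
theorem projState_fermionSpinDot_eq (t U : ℝ) (N : ℕ) (x y : Λ) :
    ((hamiltonian G t U).sectorGroundProj (nParticleSubmodule (ι := Orb Λ) N)).projState
        (fermionSpinDot x y) =
      3 * ((hamiltonian G t U).sectorGroundProj (nParticleSubmodule (ι := Orb Λ) N)).projState
        (fermionSpinZ x * fermionSpinZ y) :=
  projState_fermionSpinDot_of_commute (sectorGroundProj_mul_spinMinus G t U N)
    (sectorGroundProj_mul_spinPlus G t U N) x y

/-- The inverse of a natural number is non-negative in `ℂ`. [folklore] -/
private theorem inv_natCast_nonneg (k : ℕ) : (0 : ℂ) ≤ ((k : ℂ))⁻¹ := by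
  rw [← Complex.ofReal_natCast, ← Complex.ofReal_inv]
  exact Complex.zero_le_real.2 (inv_nonneg.2 (Nat.cast_nonneg k))

variable {G}

/-- **The sign rule in the tracial half-filled ground state, transverse component** (any `|A|, |Aᶜ|`,
`|Λ|` of either parity): `ε_x ε_y ω(S⁺_x S⁻_y) ≥ 0`, `ω = tr(P ·)/tr P`, `P` the projection onto
the half-filled ground multiplet (expand `tr (P O)` over an orthonormal frame of ground states and
use `groundState_sign_rule`). [cite: ShenQiuTian1994, Theorem and eqs. (7)–(9)]
[cite: Tasaki1998, Theorem 5.3] -/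
theorem sign_rule_transverse (hG : G.Connected) (A : Finset Λ)
    (hA : ∀ x y : Λ, G.Adj x y → (x ∈ A ↔ y ∉ A)) {t U : ℝ} (ht : t ≠ 0) (hU : 0 < U) (x y : Λ) :
    0 ≤ stagSign A x * stagSign A y *
      ((hamiltonian G t U).sectorGroundProj
          (nParticleSubmodule (ι := Orb Λ) (Fintype.card Λ))).projState
        (fermionSpinPlus x * fermionSpinMinus y) := by
  set H := hamiltonian G t U with hH
  set K : Submodule ℂ (Fock (Orb Λ)) := nParticleSubmodule (ι := Orb Λ) (Fintype.card Λ) with hK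
  obtain ⟨k, b, hk, hbV, hb1, htr⟩ := exists_frame_trace_projMatrix_map_mul (H.sectorGroundSpace K)
  have htrP : (H.sectorGroundProj K).trace = (k : ℂ) := by
    rw [Matrix.sectorGroundProj, trace_projMatrix_map_eq_finrank, ← hk]
  have htrO : (H.sectorGroundProj K * (fermionSpinPlus x * fermionSpinMinus y)).trace =
      ∑ j, star (b j) ⬝ᵥ (fermionSpinPlus x * fermionSpinMinus y) *ᵥ b j := htr _
  rw [Matrix.projState_apply, htrP, htrO, Finset.mul_sum, Finset.mul_sum]
  refine Finset.sum_nonneg fun j _ => ?_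
  have hbj : IsGroundState H (Fintype.card Λ) (b j) := by
    refine (LiebHalfFilled.isGroundState_iff G t U _ (b j)).2 ⟨fun h0 => ?_, hbV j⟩
    have h := hb1 j
    rw [h0, dotProduct_zero] at h
    exact zero_ne_one h
  rw [mul_left_comm]
  exact mul_nonneg (inv_natCast_nonneg k) (groundState_sign_rule hG A hA ht hU hbj x y)

/-- **The sign rule in the tracial half-filled ground state, longitudinal component**:
`ε_x ε_y ω(S^z_x S^z_y) ≥ 0` (isotropy `ω(S⁺_x S⁻_y) = 2 ω(S^z_x S^z_y)` and the transverse rule).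
[cite: ShenQiuTian1994, Theorem and eqs. (7)–(9)] [cite: Tasaki1998, Theorem 5.3] -/
theorem sign_rule_longitudinal (hG : G.Connected) (A : Finset Λ)
    (hA : ∀ x y : Λ, G.Adj x y → (x ∈ A ↔ y ∉ A)) {t U : ℝ} (ht : t ≠ 0) (hU : 0 < U) (x y : Λ) :
    0 ≤ stagSign A x * stagSign A y *
      ((hamiltonian G t U).sectorGroundProj
          (nParticleSubmodule (ι := Orb Λ) (Fintype.card Λ))).projState
        (fermionSpinZ x * fermionSpinZ y) := by
  have h := sign_rule_transverse hG A hA ht hU x y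
  rw [projState_spinPlus_mul_spinMinus_of_commute (sectorGroundProj_mul_spinMinus G t U _),
    mul_left_comm] at h
  have h2 := mul_nonneg (inv_natCast_nonneg 2) h
  rwa [← mul_assoc, Nat.cast_ofNat, inv_mul_cancel₀ two_ne_zero, one_mul] at h2

/-- **Shen–Qiu–Tian's theorem / Tasaki (1998) Theorem 5.3, non-strict form, in the tracial
half-filled ground state**: on a connected bipartite graph with colour class `A`, `t ≠ 0`, `U > 0`,
`ε_x ε_y ω(𝐒_x·𝐒_y) ≥ 0` for all sites `x, y` (`ω(𝐒_x·𝐒_y) = (3/2) ω(S⁺_x S⁻_y)` by `SU(2)`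
invariance of `ω`, and the transverse rule). [cite: ShenQiuTian1994, Theorem and eqs. (7)–(9)]
[cite: Tasaki1998, Theorem 5.3] -/
theorem sign_rule (hG : G.Connected) (A : Finset Λ)
    (hA : ∀ x y : Λ, G.Adj x y → (x ∈ A ↔ y ∉ A)) {t U : ℝ} (ht : t ≠ 0) (hU : 0 < U) (x y : Λ) :
    0 ≤ stagSign A x * stagSign A y *
      ((hamiltonian G t U).sectorGroundProj
          (nParticleSubmodule (ι := Orb Λ) (Fintype.card Λ))).projState (fermionSpinDot x y) := by
  rw [projState_fermionSpinDot_of_commute' (sectorGroundProj_mul_spinMinus G t U _)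
    (sectorGroundProj_mul_spinPlus G t U _), mul_left_comm]
  exact mul_nonneg (Complex.zero_le_real.2 (by norm_num)) (sign_rule_transverse hG A hA ht hU x y)

/-- `ε_x ε_y = 1` on equal sublattices. [cite: LiebPRL1989, Theorem 2] -/
private theorem stagSign_mul_of_iff {A : Finset Λ} {x y : Λ} (h : x ∈ A ↔ y ∈ A) :
    stagSign A x * stagSign A y = 1 := by
  by_cases hx : x ∈ A
  · rw [stagSign_of_mem hx, stagSign_of_mem (h.1 hx), one_mul]
  · have hy : y ∉ A := fun hy => hx (h.2 hy)
    rw [stagSign_of_mem_compl (mem_compl.2 hx), stagSign_of_mem_compl (mem_compl.2 hy)]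
    norm_num

/-- `ε_x ε_y = -1` on opposite sublattices. [cite: LiebPRL1989, Theorem 2] -/
private theorem stagSign_mul_of_iff_not {A : Finset Λ} {x y : Λ} (h : x ∈ A ↔ y ∉ A) :
    stagSign A x * stagSign A y = -1 := by
  by_cases hx : x ∈ A
  · rw [stagSign_of_mem hx, stagSign_of_mem_compl (mem_compl.2 (h.1 hx)), one_mul]
  · have hy : y ∈ A := by
      by_contra hy
      exact hx (h.2 hy)
    rw [stagSign_of_mem_compl (mem_compl.2 hx), stagSign_of_mem hy, mul_one]

/-- **Tasaki (1998) Theorem 5.3, first case (non-strict)**: `ω(𝐒_x·𝐒_y) ≥ 0` when `x, y` lie on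
the same sublattice. [cite: Tasaki1998, Theorem 5.3] [cite: ShenQiuTian1994, Theorem and eqs. (7)–(9)] -/
theorem fermionSpinDot_nonneg_of_same (hG : G.Connected) (A : Finset Λ)
    (hA : ∀ x y : Λ, G.Adj x y → (x ∈ A ↔ y ∉ A)) {t U : ℝ} (ht : t ≠ 0) (hU : 0 < U)
    {x y : Λ} (hxy : x ∈ A ↔ y ∈ A) :
    0 ≤ ((hamiltonian G t U).sectorGroundProj
        (nParticleSubmodule (ι := Orb Λ) (Fintype.card Λ))).projState (fermionSpinDot x y) := by
  have h := sign_rule hG A hA ht hU x y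
  rwa [stagSign_mul_of_iff hxy, one_mul] at h

/-- **Tasaki (1998) Theorem 5.3, second case (non-strict)**: `ω(𝐒_x·𝐒_y) ≤ 0` when `x, y` lie
on opposite sublattices — antiferromagnetic tendency between the sublattices.
[cite: Tasaki1998, Theorem 5.3] [cite: ShenQiuTian1994, Theorem and eqs. (7)–(9)] -/
theorem fermionSpinDot_nonpos_of_opposite (hG : G.Connected) (A : Finset Λ)
    (hA : ∀ x y : Λ, G.Adj x y → (x ∈ A ↔ y ∉ A)) {t U : ℝ} (ht : t ≠ 0) (hU : 0 < U)
    {x y : Λ} (hxy : x ∈ A ↔ y ∉ A) :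
    ((hamiltonian G t U).sectorGroundProj
        (nParticleSubmodule (ι := Orb Λ) (Fintype.card Λ))).projState (fermionSpinDot x y) ≤ 0 := by
  have h := sign_rule hG A hA ht hU x y
  rw [stagSign_mul_of_iff_not hxy, neg_one_mul] at h
  exact neg_nonneg.mp h

/-- In particular **nearest neighbours are antiferromagnetically correlated**: `ω(𝐒_x·𝐒_y) ≤ 0`
for every bond `x ∼ y`. [cite: Tasaki1998, Theorem 5.3 and §5.3] -/
theorem fermionSpinDot_nonpos_of_adj (hG : G.Connected) (A : Finset Λ)
    (hA : ∀ x y : Λ, G.Adj x y → (x ∈ A ↔ y ∉ A)) {t U : ℝ} (ht : t ≠ 0) (hU : 0 < U)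
    {x y : Λ} (hxy : G.Adj x y) :
    ((hamiltonian G t U).sectorGroundProj
        (nParticleSubmodule (ι := Orb Λ) (Fintype.card Λ))).projState (fermionSpinDot x y) ≤ 0 :=
  fermionSpinDot_nonpos_of_opposite hG A hA ht hU (hA x y hxy)

/-! ### Ferrimagnetic order of the tracial ground state (`|Λ|` even: Lieb's `S = S₀`) -/

/-- The half-filled ground projection is non-zero (a half-filled ground state exists).
[cite: LiebPRL1989, Theorem 2] -/
theorem sectorGroundProj_ne_zero (hG : G.Connected) (A : Finset Λ)
    (hA : ∀ x y : Λ, G.Adj x y → (x ∈ A ↔ y ∉ A)) (hΛ : Even (Fintype.card Λ))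
    {t U : ℝ} (ht : t ≠ 0) (hU : 0 < U) :
    (hamiltonian G t U).sectorGroundProj (nParticleSubmodule (ι := Orb Λ) (Fintype.card Λ)) ≠ 0 := by
  obtain ⟨ψ₀, hψ₀, -, -⟩ := exists_szZero_groundState hG A hA hΛ ht hU
  obtain ⟨hne, hmem⟩ := (LiebHalfFilled.isGroundState_iff G t U _ ψ₀).1 hψ₀
  intro h0
  have h := Matrix.sectorGroundProj_mulVec_of_mem _ _ hmem
  rw [h0, Matrix.zero_mulVec] at h
  exact hne h.symm

/-- **`S² P = S₀(S₀+1) P`**: the total spin Casimir acts as Lieb's scalar on the half-filled ground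
multiplet (`|Λ|` even). [cite: LiebPRL1989, Theorem 2] -/
theorem spinSq_mul_sectorGroundProj (hG : G.Connected) (A : Finset Λ)
    (hA : ∀ x y : Λ, G.Adj x y → (x ∈ A ↔ y ∉ A)) (hΛ : Even (Fintype.card Λ))
    {t U : ℝ} (ht : t ≠ 0) (hU : 0 < U) :
    spinSq * (hamiltonian G t U).sectorGroundProj (nParticleSubmodule (ι := Orb Λ) (Fintype.card Λ)) =
      ((liebSpin A * (liebSpin A + 1) : ℝ) : ℂ) •
        (hamiltonian G t U).sectorGroundProj (nParticleSubmodule (ι := Orb Λ) (Fintype.card Λ)) := by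
  rw [Matrix.ext_iff_mulVec]
  intro w
  rw [← mulVec_mulVec, Matrix.smul_mulVec]
  by_cases hv : (hamiltonian G t U).sectorGroundProj
      (nParticleSubmodule (ι := Orb Λ) (Fintype.card Λ)) *ᵥ w = 0
  · rw [hv, mulVec_zero, smul_zero]
  · exact spinSq_mulVec_of_isGroundState hG A hA hΛ ht hU
      ((LiebHalfFilled.isGroundState_iff G t U _ _).2
        ⟨hv, Matrix.sectorGroundProj_mulVec_mem _ _ w⟩)

/-- **Lieb's theorem in the tracial ground state**: `ω(S²) = S₀(S₀+1)`, `S₀ = ||A| - |Aᶜ||/2`.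
[cite: LiebPRL1989, Theorem 2] -/
theorem projState_spinSq (hG : G.Connected) (A : Finset Λ)
    (hA : ∀ x y : Λ, G.Adj x y → (x ∈ A ↔ y ∉ A)) (hΛ : Even (Fintype.card Λ))
    {t U : ℝ} (ht : t ≠ 0) (hU : 0 < U) :
    ((hamiltonian G t U).sectorGroundProj
        (nParticleSubmodule (ι := Orb Λ) (Fintype.card Λ))).projState spinSq =
      ((liebSpin A * (liebSpin A + 1) : ℝ) : ℂ) := by
  have h := Matrix.projState_mul_right (spinSq_mul_sectorGroundProj hG A hA hΛ ht hU)
    (1 : Matrix (Finset (Orb Λ)) (Finset (Orb Λ)) ℂ)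
  rwa [Matrix.one_mul, Matrix.projState_one (Matrix.sectorGroundProj_isHermitian _ _)
    (Matrix.sectorGroundProj_mul_self _ _) (sectorGroundProj_ne_zero hG A hA hΛ ht hU), mul_one] at h

/-- **Lieb's ferrimagnetism in the tracial ground state**: the uniform spin structure factor is
`ω(Σ_{x,y} 𝐒_x·𝐒_y) = S₀(S₀+1)` (`≥ ¼(|A| - |Aᶜ|)²`, extensive squared when `|A| - |Aᶜ| ∝ |Λ|`).
[cite: LiebPRL1989, Theorem 2] [cite: Tasaki1998, §5.3] -/
theorem projState_sum_sum_fermionSpinDot (hG : G.Connected) (A : Finset Λ)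
    (hA : ∀ x y : Λ, G.Adj x y → (x ∈ A ↔ y ∉ A)) (hΛ : Even (Fintype.card Λ))
    {t U : ℝ} (ht : t ≠ 0) (hU : 0 < U) :
    ((hamiltonian G t U).sectorGroundProj
        (nParticleSubmodule (ι := Orb Λ) (Fintype.card Λ))).projState (∑ x, ∑ y, fermionSpinDot x y) =
      ((liebSpin A * (liebSpin A + 1) : ℝ) : ℂ) := by
  rw [sum_sum_fermionSpinDot]
  exact projState_spinSq hG A hA hΛ ht hU

/-- **Shen–Qiu–Tian's ferrimagnetic long-range order in the tracial ground state**: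
`ω(𝓢_A) ≥ S₀(S₀+1) = ω(Σ_{x,y} 𝐒_x·𝐒_y)` — the staggered structure factor
`𝓢_A = Σ_{x,y} ε_x ε_y 𝐒_x·𝐒_y` dominates the uniform one, both of order `|Λ|²` when
`|A| - |Aᶜ| ∝ |Λ|` (`𝓢_A = S² - 4 Σ_{x∈A,y∈Aᶜ} 𝐒_x·𝐒_y` and `ω(𝐒_x·𝐒_y) ≤ 0` across the
sublattices). [cite: ShenQiuTian1994, Theorem and eqs. (7)–(9)] [cite: Tasaki1998, Theorem 5.3 and §5.3] -/
theorem liebSpin_le_projState_stagSpinStructure (hG : G.Connected) (A : Finset Λ)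
    (hA : ∀ x y : Λ, G.Adj x y → (x ∈ A ↔ y ∉ A)) (hΛ : Even (Fintype.card Λ))
    {t U : ℝ} (ht : t ≠ 0) (hU : 0 < U) :
    ((liebSpin A * (liebSpin A + 1) : ℝ) : ℂ) ≤
      ((hamiltonian G t U).sectorGroundProj
        (nParticleSubmodule (ι := Orb Λ) (Fintype.card Λ))).projState (stagSpinStructure A) := by
  set ω := ((hamiltonian G t U).sectorGroundProj
    (nParticleSubmodule (ι := Orb Λ) (Fintype.card Λ))).projState with hω
  have hsum : ∑ x ∈ A, ∑ y ∈ Aᶜ, ω (fermionSpinDot x y) ≤ 0 :=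
    Finset.sum_nonpos fun x hx => Finset.sum_nonpos fun y hy =>
      fermionSpinDot_nonpos_of_opposite hG A hA ht hU ⟨fun _ => mem_compl.1 hy, fun _ => hx⟩
  have h4 : (0 : ℂ) ≤ 4 := by
    rw [show (4 : ℂ) = ((4 : ℝ) : ℂ) by norm_num]
    exact Complex.zero_le_real.2 (by norm_num)
  rw [stagSpinStructure_eq_spinSq_sub_four, map_sub, map_smul, projState_spinSq hG A hA hΛ ht hU,
    smul_eq_mul]
  simp only [map_sum]
  rw [sub_eq_add_neg, ← mul_neg]
  exact le_add_of_nonneg_right (mul_nonneg h4 (neg_nonneg.2 hsum))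

/-- Real-part form: `S₀(S₀+1) ≤ Re ω(𝓢_A)`. [cite: ShenQiuTian1994, Theorem and eqs. (7)–(9)] -/
theorem liebSpin_le_re_projState_stagSpinStructure (hG : G.Connected) (A : Finset Λ)
    (hA : ∀ x y : Λ, G.Adj x y → (x ∈ A ↔ y ∉ A)) (hΛ : Even (Fintype.card Λ))
    {t U : ℝ} (ht : t ≠ 0) (hU : 0 < U) :
    liebSpin A * (liebSpin A + 1) ≤
      (((hamiltonian G t U).sectorGroundProj
        (nParticleSubmodule (ι := Orb Λ) (Fintype.card Λ))).projState (stagSpinStructure A)).re := by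
  have h := (Complex.le_def.1 (liebSpin_le_projState_stagSpinStructure hG A hA hΛ ht hU)).1
  rwa [Complex.ofReal_re] at h

/-- **The antiferromagnetic floor**: `¼(|A| - |Aᶜ|)² ≤ Re ω(𝓢_A)` — Néel long-range order of the
tracial half-filled ground state whenever `|A| - |Aᶜ| ∝ |Λ|`, for every `U > 0`.
[cite: ShenQiuTian1994, Theorem and eqs. (7)–(9)] [cite: Tasaki1998, §5.3] -/
theorem sq_card_sub_le_re_projState_stagSpinStructure (hG : G.Connected) (A : Finset Λ)
    (hA : ∀ x y : Λ, G.Adj x y → (x ∈ A ↔ y ∉ A)) (hΛ : Even (Fintype.card Λ))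
    {t U : ℝ} (ht : t ≠ 0) (hU : 0 < U) :
    ((A.card : ℝ) - (Aᶜ.card : ℝ)) ^ 2 / 4 ≤
      (((hamiltonian G t U).sectorGroundProj
        (nParticleSubmodule (ι := Orb Λ) (Fintype.card Λ))).projState (stagSpinStructure A)).re :=
  (sq_card_sub_div_four_le_liebSpin A).trans
    (liebSpin_le_re_projState_stagSpinStructure hG A hA hΛ ht hU)

/-- **The ferromagnetic floor**: `¼(|A| - |Aᶜ|)² ≤ Re ω(Σ_{x,y} 𝐒_x·𝐒_y)` (`= S₀(S₀+1)`).
[cite: LiebPRL1989, Theorem 2] [cite: Tasaki1998, §5.3] -/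
theorem sq_card_sub_le_re_projState_sum_sum_fermionSpinDot (hG : G.Connected) (A : Finset Λ)
    (hA : ∀ x y : Λ, G.Adj x y → (x ∈ A ↔ y ∉ A)) (hΛ : Even (Fintype.card Λ))
    {t U : ℝ} (ht : t ≠ 0) (hU : 0 < U) :
    ((A.card : ℝ) - (Aᶜ.card : ℝ)) ^ 2 / 4 ≤
      (((hamiltonian G t U).sectorGroundProj
        (nParticleSubmodule (ι := Orb Λ) (Fintype.card Λ))).projState
          (∑ x, ∑ y, fermionSpinDot x y)).re := by
  rw [projState_sum_sum_fermionSpinDot hG A hA hΛ ht hU, Complex.ofReal_re]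
  exact sq_card_sub_div_four_le_liebSpin A

/-- **Ferrimagnetism of the half-filled Hubbard model on an unbalanced bipartite graph, in one
statement** (tracial ground state `ω`, `|Λ|` even, any `|A|, |Aᶜ|`, `t ≠ 0`, `U > 0`):
(i) the sign rule `ω(𝐒_x·𝐒_y) ≥ 0` / `≤ 0` on equal / opposite sublattices;
(ii) `ω(Σ_{x,y} 𝐒_x·𝐒_y) = S₀(S₀+1)`; (iii) `ω(𝓢_A) ≥ S₀(S₀+1)`;
with `S₀(S₀+1) ≥ ¼(|A| - |Aᶜ|)²`: ferromagnetic and antiferromagnetic long-range order coexist when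
`|A| - |Aᶜ| ∝ |Λ|`. [cite: ShenQiuTian1994, Theorem and eqs. (7)–(9)] [cite: LiebPRL1989, Theorem 2]
[cite: Tasaki1998, Theorem 5.3 and §5.3] -/
theorem ferrimagnetic_order (hG : G.Connected) (A : Finset Λ)
    (hA : ∀ x y : Λ, G.Adj x y → (x ∈ A ↔ y ∉ A)) (hΛ : Even (Fintype.card Λ))
    {t U : ℝ} (ht : t ≠ 0) (hU : 0 < U) :
    (∀ x y : Λ, (x ∈ A ↔ y ∈ A) →
      0 ≤ ((hamiltonian G t U).sectorGroundProj
        (nParticleSubmodule (ι := Orb Λ) (Fintype.card Λ))).projState (fermionSpinDot x y)) ∧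
    (∀ x y : Λ, (x ∈ A ↔ y ∉ A) →
      ((hamiltonian G t U).sectorGroundProj
        (nParticleSubmodule (ι := Orb Λ) (Fintype.card Λ))).projState (fermionSpinDot x y) ≤ 0) ∧
    ((hamiltonian G t U).sectorGroundProj
        (nParticleSubmodule (ι := Orb Λ) (Fintype.card Λ))).projState (∑ x, ∑ y, fermionSpinDot x y) =
      ((liebSpin A * (liebSpin A + 1) : ℝ) : ℂ) ∧
    ((liebSpin A * (liebSpin A + 1) : ℝ) : ℂ) ≤
      ((hamiltonian G t U).sectorGroundProj
        (nParticleSubmodule (ι := Orb Λ) (Fintype.card Λ))).projState (stagSpinStructure A) ∧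
    ((A.card : ℝ) - (Aᶜ.card : ℝ)) ^ 2 / 4 ≤ liebSpin A * (liebSpin A + 1) :=
  ⟨fun _ _ hxy => fermionSpinDot_nonneg_of_same hG A hA ht hU hxy,
    fun _ _ hxy => fermionSpinDot_nonpos_of_opposite hG A hA ht hU hxy,
    projState_sum_sum_fermionSpinDot hG A hA hΛ ht hU,
    liebSpin_le_projState_stagSpinStructure hG A hA hΛ ht hU,
    sq_card_sub_div_four_le_liebSpin A⟩

end HalfFilledGroundState

end Literature.MathematicalPhysics.QuantumLattice
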